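import Literature.AlgebraicGeometry.AbelianSchemes.DualIsogenyQuasiInverse
import Literature.AlgebraicGeometry.AbelianSchemes.AbelianSchemeDualIsogenyHom
import Literature.AlgebraicGeometry.AbelianSchemes.AbelianSchemeHomDescentPolarized
import HarnessLib

/-!
# Polarization transport along an isogeny ROOF and a COVER: `q̄^*λ_B = p·λ`, `c̄^*λ_B = p·λ″`, `c̄′^*λ^{(q)} = n·λ′`, `F^*λ^{(q)} = q·λ`, `n = q`,
# `q̄ ≫ θ = F`, `c̄′ = f ≫ c̄ ≫ θ` ⟹ `f^*λ″ = λ′` EXACTLY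

Topic `Literature/AlgebraicGeometry/AbelianSchemes`, namespace `Literature.AlgebraicGeometry.AbelianSchemes.AbelianSchemeOver`.  THEOREMS ONLY (no definition, no
named fact, no `instance`, no notation, no `sorry`); base `S` reduced and locally noetherian (the dual-isogeny calculus ★ `DualPair.isMonHom_dualIsogenyOver`, ★
`dualIsogenyOver_comp_dualIsogenyOver_eq_pow_id`).  Cell `hodgecm-mathlib` (D-0151), FLOOR 0, P6 «MOD programme» (crux hLiu418 = stmt-HodgeConjecture-24832, `--supports`,
count-neutral), σ2 (β′) lineage of `stub_HFROB`, **BRICK L «λ-LEG»** of the HFROB ← `frob₀` derivation (card J10 step (4)): the datum's downstairs ROOF `A —q̄→ B̄ ←c̄— A″`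
((r3₀): `q̄^*λ_B = p·λ`, `c̄^*λ_B = p·λ″`) and Frobenius COVER `c̄′ : A′ → A^{(q)}` ((f3): `c̄′^*λ^{(q)} = n·λ′`, `twistNorm_eq`: `n = q`), together with ★ (DF) `F_q^*λ^{(q)} = q·λ`
and the σ2 identifications `q̄ ≫ θ = F_q`, `c̄′ = f ≫ c̄ ≫ θ` (`θ := e₁⁻¹ ≫ χ ≫ e′⁻¹`, `f` the untwist: ★ `FrobeniusTwistOfRoof`, ★ `SerreTensorRecognitionOfPoints` §3, ★
`SerreTensorUntwist`), force **`f^*λ″ = λ′` with NO residual scalar** — the `λ`-clause of `tupleIsoAt`.  Pure diagram algebra in the `dualIsogenyOver` currency (no Serre tensor, no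
Frobenius inside): `x^*μ := x ≫ μ ≫ x^∨`, `(x ≫ y)^∨ = y^∨ ≫ x^∨` (★ `dualIsogenyOver_comp`), homomorphisms commute with `[m]`, `[m]` and fppf epimorphisms cancel (★
`cancel_right_of_comp_eq_pow_id`, ★ `cancel_left_of_flat_surjective`), a quasi-inverse `r ≫ q̄ = [M]` makes `q̄^∨` right-cancellable (★ `dualIsogenyOver_comp_dualIsogenyOver_eq_pow_id`).
HC_CM is proved only modulo the 2 remaining named inputs (hLiu418, h413) until rung 0 closes; this file discharges none of them.

## The computation ([MumfordAV1970] §15 Thm. 1, §23; [Shimura1998] §13.1 Thm. 1)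
`μ := θ^*λ^{(q)}` on `B̄`.  (1) `q̄^*μ = (q̄ ≫ θ)^*λ^{(q)} = F^*λ^{(q)} = q·λ`.  (2) `q̄^*(p·μ) = pq·λ = q̄^*(q·λ_B)`, and `q̄^*` is injective on homomorphisms (`q̄` fppf epi, `q̄^∨`
right-cancellable by the quasi-inverse) ⟹ `p·μ = q·λ_B`.  (3) `p·c̄^*μ = c̄^*(q·λ_B) = pq·λ″` ⟹ `c̄^*μ = q·λ″`.  (4) `n·λ′ = c̄′^*λ^{(q)} = (f ≫ c̄ ≫ θ)^*λ^{(q)} = f^*c̄^*μ = q·f^*λ″`,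
`n = q` ⟹ `f^*λ″ = λ′`.

## Contents
* §1 `comp_comp_dualIsogenyOver_comp` (`(x ≫ y)^*μ = x^*(y^*μ)`), `mulN_comp_dualIsogenyOver` ∕ `comp_mulN_comp_dualIsogenyOver` (`[m]` passes the dual; `x^*(μ ≫ [m]) = x^*μ ≫ [m]`),
  `hat_mulN_comm`, `eq_of_comp_hat_mulN_eq` (cancel `[m]`, `m ≠ 0`), `eq_of_comp_comp_dualIsogenyOver_eq` (`q̄^*` is injective given a quasi-inverse).
* §2 **`lam_transport_of_roof_of_cover`** — the head.

## References
* [MumfordAV1970] D. Mumford, *Abelian Varieties* (1970), §15 Thm. 1 (p. 143), §23 (p. 231).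
* [Shimura1998] G. Shimura, *Abelian Varieties with Complex Multiplication and Modular Functions* (1998), §13.1 Thm. 1 (pp. 97–99).
* [MilneAV2008] J. S. Milne, *Abelian Varieties* (2008), I §9 Thm. 9.1.
-/

noncomputable section

universe u

open CategoryTheory CategoryTheory.Limits AlgebraicGeometry MonoidalCategory CartesianMonoidalCategory
open scoped MonObj

namespace Literature.AlgebraicGeometry.AbelianSchemes

namespace AbelianSchemeOver

open DualPair

variable {S : Scheme.{u}} [IsReduced S] [IsLocallyNoetherian S]

/-! ## §1 Diagram algebra -/

section Algebra

variable {A B C : AbelianSchemeOver S} (DA : A.DualPair) (DB : B.DualPair) (DC : C.DualPair)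
  (hDA : Nonempty ((Scheme.Modules.pullback (unitHatSlice DA)).obj DA.P ≅ SheafOfModules.unit _))
  (hDB : Nonempty ((Scheme.Modules.pullback (unitHatSlice DB)).obj DB.P ≅ SheafOfModules.unit _))
  (hDC : Nonempty ((Scheme.Modules.pullback (unitHatSlice DC)).obj DC.P ≅ SheafOfModules.unit _))

omit [IsReduced S] [IsLocallyNoetherian S] in
/-- **`(x ≫ y)^*μ = x^*(y^*μ)`**: `(x ≫ y) ≫ μ ≫ (x ≫ y)^∨ = x ≫ (y ≫ μ ≫ y^∨) ≫ x^∨` (★ `dualIsogenyOver_comp`). [cite: MumfordAV1970, §15 Thm. 1 (p. 143)] -/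
theorem comp_comp_dualIsogenyOver_comp (x : A.X ⟶ B.X) (y : B.X ⟶ C.X) [IsMonHom x] [IsMonHom y] (nu : C.X ⟶ DC.hat.X) :
    (x ≫ y) ≫ nu ≫ dualIsogenyOver (x ≫ y) DA DC = x ≫ (y ≫ nu ≫ dualIsogenyOver y DB DC) ≫ dualIsogenyOver x DA DB := by
  rw [dualIsogenyOver_comp x y DA DB DC]
  simp only [Category.assoc]

include hDA hDB in
/-- **Homomorphisms commute with `[m]` through the dual**: `[m]_{B̂} ≫ x^∨ = x^∨ ≫ [m]_{Â}`. [cite: MumfordAV1970, §15 Thm. 1 (p. 143)] -/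
theorem mulN_comp_dualIsogenyOver (x : A.X ⟶ B.X) [IsMonHom x] (m : ℕ) :
    DB.hat.mulN m ≫ dualIsogenyOver x DA DB = dualIsogenyOver x DA DB ≫ DA.hat.mulN m := by
  haveI := DualPair.isMonHom_dualIsogenyOver x DA DB hDB hDA
  rw [mulN_def, mulN_def, comp_pow_id_eq_pow_id_comp DB.hat (dualIsogenyOver x DA DB) m]

include hDA hDB in
/-- **`x^*(μ ≫ [m]) = x^*μ ≫ [m]`.** [cite: MumfordAV1970, §15 Thm. 1 (p. 143)] -/
theorem comp_mulN_comp_dualIsogenyOver (x : A.X ⟶ B.X) [IsMonHom x] (nu : B.X ⟶ DB.hat.X) (m : ℕ) :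
    x ≫ (nu ≫ DB.hat.mulN m) ≫ dualIsogenyOver x DA DB = (x ≫ nu ≫ dualIsogenyOver x DA DB) ≫ DA.hat.mulN m := by
  simp only [Category.assoc, mulN_comp_dualIsogenyOver DA DB hDA hDB x m]

omit [IsReduced S] [IsLocallyNoetherian S] in
/-- `[m] ≫ [m′] = [m′] ≫ [m]`. [cite: MumfordAV1970, §15 Thm. 1 (p. 143)] -/
theorem hat_mulN_comm (m m' : ℕ) : DA.hat.mulN m ≫ DA.hat.mulN m' = DA.hat.mulN m' ≫ DA.hat.mulN m := by
  rw [mulN_def, mulN_def, MonObj.comp_pow, Category.comp_id, MonObj.comp_pow, Category.comp_id, ← pow_mul, ← pow_mul, mul_comm]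

omit [IsReduced S] [IsLocallyNoetherian S] in
/-- **Cancel `[m]` on the right** (`m ≠ 0`) for homomorphisms out of an abelian scheme. [cite: MumfordAV1970, §7 Thm. 4 (p. 72)] -/
theorem eq_of_comp_hat_mulN_eq (E : AbelianSchemeOver S) {m : ℕ} (hm : m ≠ 0) (x y : E.X ⟶ DA.hat.X) [IsMonHom x] [IsMonHom y]
    (h : x ≫ DA.hat.mulN m = y ≫ DA.hat.mulN m) : x = y :=
  cancel_right_of_comp_eq_pow_id E (DA.hat.mulN m) (𝟙 DA.hat.X) hm (by rw [Category.comp_id, mulN_def]) x y h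

include hDB in
/-- **`q̄^*` IS INJECTIVE ON HOMOMORPHISMS**: if `q̄` is an fppf epimorphism with a quasi-inverse `r ≫ q̄ = [M]`, `M ≠ 0`, then `q̄ ≫ X ≫ q̄^∨ = q̄ ≫ Y ≫ q̄^∨ ⟹ X = Y` for
homomorphisms `X Y : B̄ → B̄^∧` (left-cancel `q̄`; right-cancel `q̄^∨` against `r^∨`, ★ `dualIsogenyOver_comp_dualIsogenyOver_eq_pow_id`). [cite: MumfordAV1970, §7 Thm. 4 (p. 72), §15 Thm. 1 (p. 143)]
[cite: MilneAV2008, I §9 Thm. 9.1 (p. 42)] -/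
theorem eq_of_comp_comp_dualIsogenyOver_eq (qb : A.X ⟶ B.X) [IsMonHom qb] [Flat qb.left] [Surjective qb.left] [QuasiCompact qb.left]
    (r : B.X ⟶ A.X) [IsMonHom r] {M : ℕ} (hM : M ≠ 0) (hr : r ≫ qb = (𝟙 B.X) ^ M)
    (X Y : B.X ⟶ DB.hat.X) [IsMonHom X] [IsMonHom Y]
    (h : qb ≫ X ≫ dualIsogenyOver qb DA DB = qb ≫ Y ≫ dualIsogenyOver qb DA DB) : X = Y := by
  have h1 : X ≫ dualIsogenyOver qb DA DB = Y ≫ dualIsogenyOver qb DA DB := A.cancel_left_of_flat_surjective qb h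
  exact cancel_right_of_comp_eq_pow_id B (dualIsogenyOver qb DA DB) (dualIsogenyOver r DB DA) hM
    (dualIsogenyOver_comp_dualIsogenyOver_eq_pow_id qb r DA DB hDB hr) X Y h1

end Algebra

/-! ## §2 The λ-leg -/

section Transport

variable {A A' A'' B Aq : AbelianSchemeOver S}
  (D : A.DualPair) (D' : A'.DualPair) (D'' : A''.DualPair) (DB : B.DualPair) (Dq : Aq.DualPair)
  (hD : Nonempty ((Scheme.Modules.pullback (unitHatSlice D)).obj D.P ≅ SheafOfModules.unit _))
  (hD' : Nonempty ((Scheme.Modules.pullback (unitHatSlice D')).obj D'.P ≅ SheafOfModules.unit _))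
  (hD'' : Nonempty ((Scheme.Modules.pullback (unitHatSlice D'')).obj D''.P ≅ SheafOfModules.unit _))
  (hDB : Nonempty ((Scheme.Modules.pullback (unitHatSlice DB)).obj DB.P ≅ SheafOfModules.unit _))
  (hDq : Nonempty ((Scheme.Modules.pullback (unitHatSlice Dq)).obj Dq.P ≅ SheafOfModules.unit _))
  (lam : A.X ⟶ D.hat.X) (lam' : A'.X ⟶ D'.hat.X) (lam'' : A''.X ⟶ D''.hat.X) (lamB : B.X ⟶ DB.hat.X) (lamq : Aq.X ⟶ Dq.hat.X)
  [IsMonHom lam'] [IsMonHom lam''] [IsMonHom lamB] [IsMonHom lamq]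
  (qb : A.X ⟶ B.X) [IsMonHom qb] [Flat qb.left] [Surjective qb.left] [QuasiCompact qb.left]
  (cb : A''.X ⟶ B.X) [IsMonHom cb] (θ : B.X ⟶ Aq.X) [IsMonHom θ] (f : A'.X ⟶ A''.X) [IsMonHom f]
  (r : B.X ⟶ A.X) [IsMonHom r]

include hD hD' hD'' hDB hDq in
/-- **THE λ-LEG OF HFROB: `f^*λ″ = λ′` EXACTLY.**  Hypotheses: the roof laws `q̄^*λ_B = p·λ`, `c̄^*λ_B = p·λ″` ((r3₀)), the cover law
`(f ≫ c̄ ≫ θ)^*λ^{(q)} = n·λ′` ((f3) with `c̄′ = f ≫ c̄ ≫ θ`), the Frobenius law `(q̄ ≫ θ)^*λ^{(q)} = q·λ` (★ (DF) with `F_q = q̄ ≫ θ`), `n = q`, `p ≠ 0`, `q ≠ 0`, `q̄` an fppf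
epimorphism with a quasi-inverse `r ≫ q̄ = [M]`, `M ≠ 0`, all dual pairs normalised.  Conclusion: `f ≫ λ″ ≫ f^∨ = λ′`. [cite: MumfordAV1970, §15 Thm. 1 (p. 143), §23 (p. 231)]
[cite: Shimura1998, §13.1 Thm. 1 (pp. 97–99)] -/
theorem lam_transport_of_roof_of_cover {M p n q : ℕ} (hM : M ≠ 0) (hp : p ≠ 0) (hq : q ≠ 0) (hn : n = q)
    (hr : r ≫ qb = (𝟙 B.X) ^ M)
    (hr3q : qb ≫ lamB ≫ dualIsogenyOver qb D DB = lam ≫ D.hat.mulN p)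
    (hr3c : cb ≫ lamB ≫ dualIsogenyOver cb D'' DB = lam'' ≫ D''.hat.mulN p)
    (hf3 : (f ≫ cb ≫ θ) ≫ lamq ≫ dualIsogenyOver (f ≫ cb ≫ θ) D' Dq = lam' ≫ D'.hat.mulN n)
    (hDF : (qb ≫ θ) ≫ lamq ≫ dualIsogenyOver (qb ≫ θ) D Dq = lam ≫ D.hat.mulN q) :
    f ≫ lam'' ≫ dualIsogenyOver f D' D'' = lam' := by
  subst hn
  -- instances for the dual isogenies
  haveI := DualPair.isMonHom_dualIsogenyOver qb D DB hDB hD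
  haveI := DualPair.isMonHom_dualIsogenyOver cb D'' DB hDB hD''
  haveI := DualPair.isMonHom_dualIsogenyOver θ DB Dq hDq hDB
  haveI := DualPair.isMonHom_dualIsogenyOver f D' D'' hD'' hD'
  haveI : IsCommMonObj D.hat.X := D.hat.isCommMonObj_of_isReduced_base
  haveI : IsCommMonObj D'.hat.X := D'.hat.isCommMonObj_of_isReduced_base
  haveI : IsCommMonObj D''.hat.X := D''.hat.isCommMonObj_of_isReduced_base
  haveI : IsCommMonObj DB.hat.X := DB.hat.isCommMonObj_of_isReduced_base
  haveI := D.hat.isMonHom_mulN p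
  haveI := D.hat.isMonHom_mulN n
  haveI := D''.hat.isMonHom_mulN p
  haveI := D''.hat.isMonHom_mulN n
  haveI := D'.hat.isMonHom_mulN n
  haveI := DB.hat.isMonHom_mulN p
  haveI := DB.hat.isMonHom_mulN n
  -- μ := θ^* λ^{(q)}
  set nu : B.X ⟶ DB.hat.X := θ ≫ lamq ≫ dualIsogenyOver θ DB Dq with hnu
  haveI : IsMonHom nu := by rw [hnu]; infer_instance
  -- (1) q̄^* μ = q·λ
  have h1 : qb ≫ nu ≫ dualIsogenyOver qb D DB = lam ≫ D.hat.mulN n := by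
    rw [hnu, ← comp_comp_dualIsogenyOver_comp D DB Dq qb θ lamq, hDF]
  -- (2) p·μ = q·λ_B
  have h2 : nu ≫ DB.hat.mulN p = lamB ≫ DB.hat.mulN n := by
    refine eq_of_comp_comp_dualIsogenyOver_eq D DB hDB qb r hM hr _ _ ?_
    rw [comp_mulN_comp_dualIsogenyOver D DB hD hDB qb nu p, h1, comp_mulN_comp_dualIsogenyOver D DB hD hDB qb lamB n, hr3q, Category.assoc, Category.assoc, hat_mulN_comm]
  -- (3) c̄^* μ = q·λ″
  have h3 : cb ≫ nu ≫ dualIsogenyOver cb D'' DB = lam'' ≫ D''.hat.mulN n := by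
    refine eq_of_comp_hat_mulN_eq D'' A'' hp _ _ ?_
    rw [← comp_mulN_comp_dualIsogenyOver D'' DB hD'' hDB cb nu p, h2, comp_mulN_comp_dualIsogenyOver D'' DB hD'' hDB cb lamB n, hr3c, Category.assoc, Category.assoc, hat_mulN_comm]
  -- (4) n·λ′ = c̄′^* λ^{(q)} = f^* c̄^* μ = q · f^* λ″
  have h4 : (f ≫ lam'' ≫ dualIsogenyOver f D' D'') ≫ D'.hat.mulN n = lam' ≫ D'.hat.mulN n := by
    rw [← hf3, comp_comp_dualIsogenyOver_comp D' D'' Dq f (cb ≫ θ) lamq, comp_comp_dualIsogenyOver_comp D'' DB Dq cb θ lamq, ← hnu, h3,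
      comp_mulN_comp_dualIsogenyOver D' D'' hD' hD'' f lam'' n]
  exact eq_of_comp_hat_mulN_eq D' A' hq _ _ h4

end Transport

end AbelianSchemeOver

end Literature.AlgebraicGeometry.AbelianSchemes

end
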